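import Mathlib
import HarnessLib
import Summits.HubbardSuperconductivity.HubbardSuperconductivity.Theorems.KLProgrammeKLRegimeEngineSliceFamPieceTel
import Summits.HubbardSuperconductivity.HubbardSuperconductivity.Theorems.KLProgrammeKLRegimeEngineSliceCovPieceTel
import Summits.HubbardSuperconductivity.HubbardSuperconductivity.Theorems.KLProgrammeKLRegimeSectorSliceRowsChain

/-!
# Route `KLProgramme` — crux K3 ENGINE (stmt-HubbardSuperconductivity-20437) stub (b) conj. 2 «(c-D)² FAMILY TELESCOPE», brick (D5j†): the
# SIMULTANEOUS family+band TELESCOPE along a chain of frames whose consecutive level increments are the mean-free flow pieces — TELESCOPE form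
# (weight `1 ≤ D_w·x₀`, `Λ_{nw}β/(2M) ≤ D_w·x₀·s₀`, `Λ_{nw} ≤ D_w·ρ`; family amplitude `5C₁G₀Λ_m`; covariance data at the reference scale `x₀ = 4^{i₀}`)

Cell `gate-hubbard-kl`, seat hubbard-kl-k3c3-p2 (g11); F1-DESIGN §10.  A chain of frames `K_f : ℕ → TrigPolyC4v` with
`e_{K_f(i+1)} − e_{K_f(i)} = evalM (klFlowPiece i) − mean_i` for `i₀ ≤ i < i₀ + d` (`FlowPieceJetsAt`, `FlowPieceOscAt`), every frame in the symbol class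
(`C²`-size `≤ A`, third derivatives affine in `4^i`, band jets `K_{b1}, K_{b2}, K_{b30} + K_{b31}4^i`), the conjugated matrices
`A(i) = S(F̃^{K_f i})ᵀ C^{K_f i} S(F̃^{K_f i})` (fat family at sector scale `m+1` AND slice covariance on the same frame).  The step
`A(i+1) − A(i)` splits (`conj_step_split`, `…SectorSliceRowsChain`) into the FAMILY piece at the new band (`rowSumWt_sliceCT_famDefect_pieceTel_le`,
`…EngineSliceFamPieceTel`) plus the COVARIANCE piece at the old family (`rowSumWt_sliceCT_covDefect_pieceTel_le`, `…EngineSliceCovPieceTel`);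
both are `x`-free after the weight comparison `D = D_w·4^i` with only `1 ≤ D_w·x₀`, `Λ_{nw}β/(2M) ≤ D_w·x₀·s₀`, `Λ_{nw} ≤ D_w·ρ` (so `D_w ~ max(1/x₀, Λ_{nw}/ρ)`); the family thresholds, stated at
`x₀ = 4^{i₀}`, propagate up the chain by monotonicity.  Hence (`rowSumWt/colSumWt_norm_chain_le_const`) **`rowSumWt_sliceCT_famBand_tel_le`**:
`klScaleWt`-rows AND columns of `A(i₀ + d)` are `≤` those of `A(i₀)` `+ d·(Φ + Ψ)`, `Φ = 8·(18·(D_w·(2·(√Ŵ·√N̄·(5C₁G₀Λ_m·(βL²)⁻²·4βL²/Λ)))))`,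
`Ψ = 8·(9·(D_w x₀·(√Ŵ(x₀)·√N̄·A₀^♯(x₀))))` (companions `…FamBandTelescope(Sharp)`: `1 ≤ D_w` resp. `Λ_{nw}β/(2M) ≤ D_w·s₀`).  No sorry. [cite: BenfattoGiulianiMastropietro2006, §2.7 (2.66)–(2.67), §2.8 (2.81), §3 (3.2)–(3.8)]
-/

noncomputable section

namespace Summit.HubbardSuperconductivity.HubbardSuperconductivity.Theorems.TorusFourierL2

set_option linter.dupNamespace false -- summit = problem name (single-conjunct summit), D-0017

open Set Finset Literature.MathematicalPhysics.QuantumLattice Literature.MathematicalPhysics.QuantumLattice.BandSectorCounting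
open Literature.MathematicalPhysics.QuantumLattice.FermiRG Literature.Probability.LatticeModels Literature.Analysis.SpecialFunctions
open Summit.HubbardSuperconductivity.HubbardSuperconductivity.Theorems.DispersionFlow
open Summit.HubbardSuperconductivity.HubbardSuperconductivity.Theorems.KLRegimeSplit
open Summit.HubbardSuperconductivity.HubbardSuperconductivity.Theorems.KLProgrammeLegKernels
open Summit.HubbardSuperconductivity.HubbardSuperconductivity.Theorems.PerturbedFermiCurve
open scoped Real Nat

section TelescopeTel

open Classical

set_option maxHeartbeats 1000000 -- the accumulated binder list of BOTH pieces: every `variable` command below re-elaborates all of it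

variable {L M : ℕ} [NeZero L] [NeZero M] {a b : ℝ} (B : BandBounds a b) (Kf : ℕ → TrigPolyC4v) (i₀ dn : ℕ) {A A₃₀ A₃₁ : ℝ}
  (hA : ∀ i, i₀ ≤ i → i ≤ i₀ + dn → ∀ p : Momentum, ∀ j ≤ 2, ‖iteratedFDeriv ℝ j (frameShift (Kf i)) p‖ ≤ A)
  (hA3 : ∀ i, i₀ ≤ i → i ≤ i₀ + dn → ∀ p : Momentum, ‖iteratedFDeriv ℝ 3 (frameShift (Kf i)) p‖ ≤ A₃₀ + A₃₁ * (4 : ℝ) ^ i)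
  (hA₃₀ : 0 ≤ A₃₀) (hA₃₁ : 0 ≤ A₃₁) (hADt : 2 * A < B.Dtmin)
  {μ e₀ z β : ℝ} (he : 0 < e₀) (hz : 0 < z) (hz1 : z ≤ 1) (hgap : e₀ + A + z ^ 2 < -μ) (h3 : e₀ + A - μ ≤ 3)
  (hlo : a ≤ μ - A - e₀) (hhi : μ + A + e₀ ≤ b) (hβ : 0 < β) (hρA : 4 * A < 2 * B.rhomin)
  (m : ℕ) (hMm : klScale e₀ m * β < π * (2 * M - 5))
  {d : ℝ} (hd : 0 ≤ d) (hd1 : ∀ u, |deriv (bgmCutoffSq e₀) u| ≤ d) (hd2 : ∀ u, |iteratedDeriv 2 (bgmCutoffSq e₀) u| ≤ d)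
  (hd3 : ∀ u, |iteratedDeriv 3 (bgmCutoffSq e₀) u| ≤ d) (hd4 : ∀ u, |iteratedDeriv 4 (bgmCutoffSq e₀) u| ≤ d)
  {Ba : ℝ} (hB0 : 0 ≤ Ba)
  (hB : ∀ (i : ℕ), i ≤ 2 → ∀ (n : ℕ) (ω : ℤ) (θ₀ : ℝ) (q w : Fin 2 → ℝ) (t : ℝ) {r₀ : ℝ}, 0 < r₀ →
    r₀ ≤ ‖momToComplex (q + t • w)‖ → |sectorRelAngle θ₀ (q + t • w)| < π →
    ‖iteratedDeriv i (fun t : ℝ => sectorWeightCirc n ω (polarAngle (q + t • w))) t‖ ≤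
      (2 : ℕ)! * Ba * ((1 + (sectorWidth n)⁻¹ * (2 : ℕ)!) * ‖momToComplex w‖ / r₀) ^ i)
  {Ba3 : ℝ} (hB30 : 0 ≤ Ba3)
  (hB3 : ∀ (i : ℕ), i ≤ 3 → ∀ (n : ℕ) (ω : ℤ) (θ₀ : ℝ) (q w : Fin 2 → ℝ) (t : ℝ) {r₀ : ℝ}, 0 < r₀ →
    r₀ ≤ ‖momToComplex (q + t • w)‖ → |sectorRelAngle θ₀ (q + t • w)| < π →
    ‖iteratedDeriv i (fun t : ℝ => sectorWeightCirc n ω (polarAngle (q + t • w))) t‖ ≤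
      (3 : ℕ)! * Ba3 * ((1 + (sectorWidth n)⁻¹ * (3 : ℕ)!) * ‖momToComplex w‖ / r₀) ^ i)
  {Nr : ℝ} (hNr : 2 ≤ Nr) (hLz : 3 * |2 * π / L| * (Nr + 1 / 2) ≤ z) {R₀ : ℕ} (hR₀ : 2 * (2 * Nr + 1) * (R₀ : ℝ) < L)
  -- the chain's increments: the mean-free flow pieces `i₀ ≤ i < i₀ + d` (`x₀ = 4^{i₀}`)
  {x₀ G₀ Gi₁ Gi₂ Gi₃ ε₃₀ ε₃₁ a₃s : ℝ} (hx₀ : x₀ = (4 : ℝ) ^ i₀) (hG₀pos : 0 < G₀)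
  {U c'' : ℝ} {R : RenConsts} (hR : ∀ j, 0 ≤ R.Gfr j) (hc'' : 0 ≤ c'')
  (hJ : ∀ i, i₀ ≤ i → i < i₀ + dn → FlowPieceJetsAt L M β U μ R i) (hO : ∀ i, i₀ ≤ i → i < i₀ + dn → FlowPieceOscAt L M c'' β U μ i)
  (hinc : ∀ i, i₀ ≤ i → i < i₀ + dn → (fun q : Momentum => frameLevel μ (Kf (i + 1)) q - frameLevel μ (Kf i) q) =
    fun q => evalM (klFlowPiece L M β U μ i) q - klAngularMean (klLocalPart L M β U μ (klFlowFrameU L M β U μ i) i))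
  (hG₀ : G₀ = c'' * |U| * uPow 0 U) (hGi₁ : Gi₁ = R.Gfr 1 * uPow 1 U) (hGi₂ : Gi₂ = R.Gfr 2 * uPow 2 U) (hGi₃ : Gi₃ = R.Gfr 3 * uPow 3 U)
  (hε₃₀ : ε₃₀ = 4 + 8 * A₃₀) (hε₃₁ : ε₃₁ = 32 * A₃₁) (ha₃s : (A₃₀ + A₃₁) * klScale e₀ m ^ 2 ≤ a₃s)
  (hGΛ : G₀ / x₀ ^ 2 ≤ klScale e₀ m)
  -- the slice; the frames' band jets (third order affine in `4^i`); the cutoff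
  {Λ Λ' : ℝ} (hΛ : 0 < Λ) (hΛΛ' : Λ ≤ Λ') (hM' : Λ' < π * (2 * M - 5) / β)
  {Kb₁ Kb₂ Kb₃₀ Kb₃₁ K₃s : ℝ} (hKb₁ : ∀ i, i₀ ≤ i → i ≤ i₀ + dn → ∀ p, ‖fderiv ℝ (frameLevel μ (Kf i)) p‖ ≤ Kb₁)
  (hKb₂ : ∀ i, i₀ ≤ i → i ≤ i₀ + dn → ∀ p, ‖iteratedFDeriv ℝ 2 (frameLevel μ (Kf i)) p‖ ≤ Kb₂)
  (hKb₃ : ∀ i, i₀ ≤ i → i ≤ i₀ + dn → ∀ p, ‖iteratedFDeriv ℝ 3 (frameLevel μ (Kf i)) p‖ ≤ Kb₃₀ + Kb₃₁ * (4 : ℝ) ^ i)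
  (hKb₃₀ : 0 ≤ Kb₃₀) (hKb₃₁ : 0 ≤ Kb₃₁) (hK₃s : Kb₃₀ + Kb₃₁ ≤ K₃s)
  {bs b₂ b₂' b₃ b₃' : ℝ} (hbs : 0 ≤ bs) (hKb₁b : Kb₁ ≤ bs) (hb₂ : Kb₂ ≤ b₂) (hb₂' : 0 ≤ b₂') (hb₃ : Kb₃₀ ≤ b₃) (hb₃' : 4 * Kb₃₁ ≤ b₃')
  {B₁ B₂ B₃ B₄ : ℝ} (hB₁ : ∀ x, |deriv salmhoferCutoff x| ≤ B₁) (hB₂ : ∀ x, |deriv (deriv salmhoferCutoff) x| ≤ B₂)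
  (hB₃ : ∀ x, |deriv (deriv (deriv salmhoferCutoff)) x| ≤ B₃) (hB₄ : ∀ x, |deriv (deriv (deriv (deriv salmhoferCutoff))) x| ≤ B₄)

-- the FAMILY piece's names (instantiate with `rfl`): common, iso family, tangent family, time
variable {ρf κ C₁ ε₂ ζ t 𝔮₁ 𝔮₂ 𝔮₃₀ 𝔮₃₁ d₁ w₁ d₂ w₂ d₃₀ d₃₁ w₃₀ w₃₁ o₁₀ o₁₁ o₂₀ o₂₁ o₂₂ o₃₀ o₃₁ o₃₂ o₃₃
    R₁₀ R₁₁ R₂₀ R₂₁ R₂₂ R₃₀ R₃₁ R₃₂ R₃₃ r₁₀ r₁₁ r₂₀ r₂₁ r₂₂ r₃₀ r₃₁ r₃₂ r₃₃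
    tv 𝔳₁ 𝔳₂ 𝔳₃₀ 𝔳₃₁ dv₁ wv₁ dv₂ wv₂ dv₃₀ dv₃₁ wv₃₀ wv₃₁ ov₁₀ ov₁₁ ov₂₀ ov₂₁ ov₂₂ ov₃₀ ov₃₁ ov₃₂ ov₃₃
    Rv₁₀ Rv₁₁ Rv₂₀ Rv₂₁ Rv₂₂ Rv₃₀ Rv₃₁ Rv₃₂ Rv₃₃ rv₁₀ rv₁₁ rv₂₀ rv₂₁ rv₂₂ rv₃₀ rv₃₁ rv₃₂ rv₃₃
    qt₁ qt₂ qt₃ Dt₁ Dt₂ θ₁ θ₂ θ₃ : ℝ}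
  (hρf : ρf = (klScale e₀ m + B.smax * B.Dtmin * (3 * sectorWidth (m + 1) / 4)) / (B.Dtmin - 2 * A) +
    π * Real.sqrt 2 * (1 + (4 + 2 * A) / (B.Dtmin - 2 * A)) * sectorWidth (m + 1))
  (hκ : κ = e₀ ^ 2 / klScale e₀ m ^ 2) (hC₁ : C₁ = d * e₀ ^ 2 / klScale e₀ m ^ 2)
  (hε₂ : ε₂ = 4 + 4 * A) (hζ : ζ = 1 + 6 * (sectorWidth (m + 1))⁻¹)
  -- iso family (`t = 4 + 2A`)
  (ht : t = 4 + 2 * A)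
  (h𝔮₁ : 𝔮₁ = 2 * (d * e₀ ^ 2) * t / klScale e₀ m + 9 * (12 * Ba3 * ζ))
  (h𝔮₂ : 𝔮₂ = (4 * (d * e₀ ^ 4) + 2 * (d * e₀ ^ 2)) * t ^ 2 / klScale e₀ m ^ 2 + 2 * (d * e₀ ^ 2) * (4 + 4 * A) / klScale e₀ m +
    4 * (d * e₀ ^ 2) * t / klScale e₀ m * (9 * (12 * Ba3 * ζ)) + 9 * ((12 * Ba3 + 72 * Ba3 ^ 2) * ζ ^ 2))
  (h𝔮₃₀ : 𝔮₃₀ = (8 * (d * e₀ ^ 6) + 12 * (d * e₀ ^ 4)) * t ^ 3 / klScale e₀ m ^ 3 + (12 * (d * e₀ ^ 4) + 6 * (d * e₀ ^ 2)) * (t * (4 + 4 * A)) / klScale e₀ m ^ 2 +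
    2 * (d * e₀ ^ 2) * ε₃₀ / klScale e₀ m +
    3 * (((4 * (d * e₀ ^ 4) + 2 * (d * e₀ ^ 2)) * t ^ 2 / klScale e₀ m ^ 2 + 2 * (d * e₀ ^ 2) * (4 + 4 * A) / klScale e₀ m) * (9 * (12 * Ba3 * ζ))) +
    3 * (2 * (d * e₀ ^ 2) * t / klScale e₀ m * (9 * ((12 * Ba3 + 72 * Ba3 ^ 2) * ζ ^ 2))) + 9 * ((12 * Ba3 + 216 * Ba3 ^ 2) * ζ ^ 3))
  (h𝔮₃₁ : 𝔮₃₁ = 2 * (d * e₀ ^ 2) * ε₃₁ / klScale e₀ m)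
  (hd₁ : d₁ = 4 * klScale e₀ m * t) (hw₁ : w₁ = 2 * (t * G₀ + 2 * klScale e₀ m * (2 * Gi₁) + G₀ * (2 * Gi₁))) (hd₂ : d₂ = 2 * (t ^ 2 + 2 * klScale e₀ m * ε₂))
  (hw₂ : w₂ = 2 * (ε₂ * G₀ + 2 * t * (2 * Gi₁) + 2 * klScale e₀ m * (4 * Gi₂) + (2 * Gi₁) ^ 2 + G₀ * (4 * Gi₂)))
  (hd₃₀ : d₃₀ = 2 * (3 * t * ε₂ + 2 * klScale e₀ m * ε₃₀)) (hd₃₁ : d₃₁ = 4 * klScale e₀ m * ε₃₁)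
  (hw₃₀ : w₃₀ = 2 * (ε₃₀ * G₀ + ε₃₁ * G₀ + 3 * ε₂ * (2 * Gi₁) + 3 * t * (4 * Gi₂) + 3 * (2 * Gi₁) * (4 * Gi₂) + G₀ * (8 * Gi₃))) (hw₃₁ : w₃₁ = 4 * klScale e₀ m * (8 * Gi₃))
  (ho₁₀ : o₁₀ = t / klScale e₀ m) (ho₁₁ : o₁₁ = 2 * (2 * Gi₁) / G₀) (ho₂₀ : o₂₀ = ε₂ / klScale e₀ m + (2 * Gi₁) ^ 2 / (klScale e₀ m * G₀))
  (ho₂₁ : o₂₁ = 2 * t * (2 * Gi₁) / (klScale e₀ m * G₀)) (ho₂₂ : o₂₂ = 2 * (4 * Gi₂) / G₀)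
  (ho₃₀ : o₃₀ = ε₃₀ / klScale e₀ m) (ho₃₁ : o₃₁ = ε₃₁ / klScale e₀ m + 3 * ε₂ * (2 * Gi₁) / (klScale e₀ m * G₀) + 3 * (2 * Gi₁) * (4 * Gi₂) / (klScale e₀ m * G₀))
  (ho₃₂ : o₃₂ = 3 * t * (4 * Gi₂) / (klScale e₀ m * G₀)) (ho₃₃ : o₃₃ = 2 * (8 * Gi₃) / G₀)
  (hR₁₀ : R₁₀ = κ * (d₁ + w₁) + o₁₀) (hR₁₁ : R₁₁ = o₁₁)
  (hR₂₀ : R₂₀ = κ ^ 2 * (d₁ + w₁) ^ 2 + κ * (o₁₀ * (2 * d₁ + w₁)) + κ * (d₂ + w₂) + o₂₀) (hR₂₁ : R₂₁ = κ * (o₁₁ * (2 * d₁ + w₁)) + o₂₁)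
  (hR₂₂ : R₂₂ = o₂₂)
  (hR₃₀ : R₃₀ = κ ^ 3 * (d₁ + w₁) ^ 3 + κ ^ 2 * (o₁₀ * (3 * d₁ ^ 2 + 3 * d₁ * w₁ + w₁ ^ 2)) +
    3 * (κ ^ 2 * ((d₁ + w₁) * (d₂ + w₂)) + κ * (d₁ * o₂₀ + o₁₀ * d₂ + o₁₀ * w₂)) + κ * (d₃₀ + w₃₀) + o₃₀)
  (hR₃₁ : R₃₁ = κ ^ 2 * (o₁₁ * (3 * d₁ ^ 2 + 3 * d₁ * w₁ + w₁ ^ 2)) + 3 * (κ * (d₁ * o₂₁ + o₁₁ * d₂ + o₁₁ * w₂)) + κ * (d₃₁ + w₃₁) + o₃₁)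
  (hR₃₂ : R₃₂ = 3 * (κ * (d₁ * o₂₂)) + o₃₂) (hR₃₃ : R₃₃ = o₃₃)
  (hr₁₀ : r₁₀ = R₁₀ + 𝔮₁) (hr₁₁ : r₁₁ = R₁₁) (hr₂₀ : r₂₀ = R₂₀ + 2 * R₁₀ * 𝔮₁ + 𝔮₂) (hr₂₁ : r₂₁ = R₂₁ + 2 * R₁₁ * 𝔮₁) (hr₂₂ : r₂₂ = R₂₂)
  (hr₃₀ : r₃₀ = R₃₀ + 3 * R₂₀ * 𝔮₁ + 3 * R₁₀ * 𝔮₂ + 𝔮₃₀) (hr₃₁ : r₃₁ = R₃₁ + 3 * R₂₁ * 𝔮₁ + 3 * R₁₁ * 𝔮₂ + 𝔮₃₁)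
  (hr₃₂ : r₃₂ = R₃₂ + 3 * R₂₂ * 𝔮₁) (hr₃₃ : r₃₃ = R₃₃)
  -- tangent family (`t_v = (4+2A)/(N_r−1) + K₂√2ρ_f`)
  (htv : tv = (4 + 2 * A) / (Nr - 1) + Kb₂ * (Real.sqrt 2 * ρf))
  (h𝔳₁ : 𝔳₁ = 2 * (d * e₀ ^ 2) * tv / klScale e₀ m + 9 * (12 * Ba3 * ζ))
  (h𝔳₂ : 𝔳₂ = (4 * (d * e₀ ^ 4) + 2 * (d * e₀ ^ 2)) * tv ^ 2 / klScale e₀ m ^ 2 + 2 * (d * e₀ ^ 2) * (4 + 4 * A) / klScale e₀ m +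
    4 * (d * e₀ ^ 2) * tv / klScale e₀ m * (9 * (12 * Ba3 * ζ)) + 9 * ((12 * Ba3 + 72 * Ba3 ^ 2) * ζ ^ 2))
  (h𝔳₃₀ : 𝔳₃₀ = (8 * (d * e₀ ^ 6) + 12 * (d * e₀ ^ 4)) * tv ^ 3 / klScale e₀ m ^ 3 + (12 * (d * e₀ ^ 4) + 6 * (d * e₀ ^ 2)) * (tv * (4 + 4 * A)) / klScale e₀ m ^ 2 +
    2 * (d * e₀ ^ 2) * ε₃₀ / klScale e₀ m +
    3 * (((4 * (d * e₀ ^ 4) + 2 * (d * e₀ ^ 2)) * tv ^ 2 / klScale e₀ m ^ 2 + 2 * (d * e₀ ^ 2) * (4 + 4 * A) / klScale e₀ m) * (9 * (12 * Ba3 * ζ))) +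
    3 * (2 * (d * e₀ ^ 2) * tv / klScale e₀ m * (9 * ((12 * Ba3 + 72 * Ba3 ^ 2) * ζ ^ 2))) + 9 * ((12 * Ba3 + 216 * Ba3 ^ 2) * ζ ^ 3))
  (h𝔳₃₁ : 𝔳₃₁ = 2 * (d * e₀ ^ 2) * ε₃₁ / klScale e₀ m)
  (hdv₁ : dv₁ = 4 * klScale e₀ m * tv) (hwv₁ : wv₁ = 2 * (tv * G₀ + 2 * klScale e₀ m * (2 * Gi₁) + G₀ * (2 * Gi₁))) (hdv₂ : dv₂ = 2 * (tv ^ 2 + 2 * klScale e₀ m * ε₂))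
  (hwv₂ : wv₂ = 2 * (ε₂ * G₀ + 2 * tv * (2 * Gi₁) + 2 * klScale e₀ m * (4 * Gi₂) + (2 * Gi₁) ^ 2 + G₀ * (4 * Gi₂)))
  (hdv₃₀ : dv₃₀ = 2 * (3 * tv * ε₂ + 2 * klScale e₀ m * ε₃₀)) (hdv₃₁ : dv₃₁ = 4 * klScale e₀ m * ε₃₁)
  (hwv₃₀ : wv₃₀ = 2 * (ε₃₀ * G₀ + ε₃₁ * G₀ + 3 * ε₂ * (2 * Gi₁) + 3 * tv * (4 * Gi₂) + 3 * (2 * Gi₁) * (4 * Gi₂) + G₀ * (8 * Gi₃))) (hwv₃₁ : wv₃₁ = 4 * klScale e₀ m * (8 * Gi₃))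
  (hov₁₀ : ov₁₀ = tv / klScale e₀ m) (hov₁₁ : ov₁₁ = 2 * (2 * Gi₁) / G₀) (hov₂₀ : ov₂₀ = ε₂ / klScale e₀ m + (2 * Gi₁) ^ 2 / (klScale e₀ m * G₀))
  (hov₂₁ : ov₂₁ = 2 * tv * (2 * Gi₁) / (klScale e₀ m * G₀)) (hov₂₂ : ov₂₂ = 2 * (4 * Gi₂) / G₀)
  (hov₃₀ : ov₃₀ = ε₃₀ / klScale e₀ m) (hov₃₁ : ov₃₁ = ε₃₁ / klScale e₀ m + 3 * ε₂ * (2 * Gi₁) / (klScale e₀ m * G₀) + 3 * (2 * Gi₁) * (4 * Gi₂) / (klScale e₀ m * G₀))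
  (hov₃₂ : ov₃₂ = 3 * tv * (4 * Gi₂) / (klScale e₀ m * G₀)) (hov₃₃ : ov₃₃ = 2 * (8 * Gi₃) / G₀)
  (hRv₁₀ : Rv₁₀ = κ * (dv₁ + wv₁) + ov₁₀) (hRv₁₁ : Rv₁₁ = ov₁₁)
  (hRv₂₀ : Rv₂₀ = κ ^ 2 * (dv₁ + wv₁) ^ 2 + κ * (ov₁₀ * (2 * dv₁ + wv₁)) + κ * (dv₂ + wv₂) + ov₂₀) (hRv₂₁ : Rv₂₁ = κ * (ov₁₁ * (2 * dv₁ + wv₁)) + ov₂₁)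
  (hRv₂₂ : Rv₂₂ = ov₂₂)
  (hRv₃₀ : Rv₃₀ = κ ^ 3 * (dv₁ + wv₁) ^ 3 + κ ^ 2 * (ov₁₀ * (3 * dv₁ ^ 2 + 3 * dv₁ * wv₁ + wv₁ ^ 2)) +
    3 * (κ ^ 2 * ((dv₁ + wv₁) * (dv₂ + wv₂)) + κ * (dv₁ * ov₂₀ + ov₁₀ * dv₂ + ov₁₀ * wv₂)) + κ * (dv₃₀ + wv₃₀) + ov₃₀)
  (hRv₃₁ : Rv₃₁ = κ ^ 2 * (ov₁₁ * (3 * dv₁ ^ 2 + 3 * dv₁ * wv₁ + wv₁ ^ 2)) + 3 * (κ * (dv₁ * ov₂₁ + ov₁₁ * dv₂ + ov₁₁ * wv₂)) + κ * (dv₃₁ + wv₃₁) + ov₃₁)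
  (hRv₃₂ : Rv₃₂ = 3 * (κ * (dv₁ * ov₂₂)) + ov₃₂) (hRv₃₃ : Rv₃₃ = ov₃₃)
  (hrv₁₀ : rv₁₀ = Rv₁₀ + 𝔳₁) (hrv₁₁ : rv₁₁ = Rv₁₁) (hrv₂₀ : rv₂₀ = Rv₂₀ + 2 * Rv₁₀ * 𝔳₁ + 𝔳₂) (hrv₂₁ : rv₂₁ = Rv₂₁ + 2 * Rv₁₁ * 𝔳₁) (hrv₂₂ : rv₂₂ = Rv₂₂)
  (hrv₃₀ : rv₃₀ = Rv₃₀ + 3 * Rv₂₀ * 𝔳₁ + 3 * Rv₁₀ * 𝔳₂ + 𝔳₃₀) (hrv₃₁ : rv₃₁ = Rv₃₁ + 3 * Rv₂₁ * 𝔳₁ + 3 * Rv₁₁ * 𝔳₂ + 𝔳₃₁)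
  (hrv₃₂ : rv₃₂ = Rv₃₂ + 3 * Rv₂₂ * 𝔳₁) (hrv₃₃ : rv₃₃ = Rv₃₃)
  -- time
  (hqt₁ : qt₁ = 2 * (d * e₀ ^ 2) * |2 * π / β| / klScale e₀ m) (hqt₂ : qt₂ = (4 * (d * e₀ ^ 4) + 2 * (d * e₀ ^ 2)) * (2 * π / β) ^ 2 / klScale e₀ m ^ 2)
  (hqt₃ : qt₃ = (8 * (d * e₀ ^ 6) + 12 * (d * e₀ ^ 4)) * |2 * π / β| ^ 3 / klScale e₀ m ^ 3)
  (hDt₁ : Dt₁ = 2 * klScale e₀ m * |2 * π / β|) (hDt₂ : Dt₂ = 2 * (2 * π / β) ^ 2)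
  (hθ₁ : θ₁ = κ * Dt₁ + qt₁) (hθ₂ : θ₂ = κ ^ 2 * Dt₁ ^ 2 + κ * Dt₂ + 2 * (κ * Dt₁) * qt₁ + qt₂)
  (hθ₃ : θ₃ = κ ^ 3 * Dt₁ ^ 3 + 3 * (κ ^ 2 * (Dt₁ * Dt₂)) + 3 * ((κ ^ 2 * Dt₁ ^ 2 + κ * Dt₂) * qt₁) + 3 * (κ * Dt₁ * qt₂) + qt₃)
  -- the slot constant dominates the tangent slot plus the transfer `G₁/x₀`
  (htvb : tv + Gi₁ / x₀ ≤ bs)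

-- the COVARIANCE piece's names (instantiate with `rfl`): cells, profile polynomials, slots
variable {ℓ₁ ℓ Gp₁ Gp₂ Gp₃ wsi τt Ae1 Ae2 An1 An2 Av1 Av2 : ℝ}
  (hℓ₁ : ℓ₁ = 2 * π / L) (hℓ : ℓ = 2 * π / L * (Nr + 1 / 2))
  (hGp₁ : Gp₁ = d * e₀ ^ 2 * 1 + 1 * (d * e₀ ^ 2)) (hGp₂ : Gp₂ = d * e₀ ^ 4 * 1 + 2 * (d * e₀ ^ 2) * (d * e₀ ^ 2) + 1 * (d * e₀ ^ 4))
  (hGp₃ : Gp₃ = d * e₀ ^ 6 * 1 + 3 * (d * e₀ ^ 4) * (d * e₀ ^ 2) + 3 * (d * e₀ ^ 2) * (d * e₀ ^ 4) + 1 * (d * e₀ ^ 6))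
  (hwsi : wsi = (sectorWidth (m + 1))⁻¹)
  (hτt : τt = |2 * π / L| * (4 + 2 * A) + Kb₂ * (Real.sqrt 2 * ρf) * (Real.sqrt 2 * ℓ))
  (hAe1 : Ae1 = 2 * Gp₁ * ((4 + 2 * A) * ℓ₁ + ε₂ * (ρf + 2 * ℓ₁) * ℓ₁) / klScale e₀ m * 1 + 1 * 1 * (9 * (4 * Ba * ((1 + 2 * wsi) * (2 * ℓ₁)))))
  (hAe2 : Ae2 = ((4 * Gp₂ + 2 * Gp₁) * ((4 + 2 * A) * ℓ₁ + ε₂ * (ρf + 2 * ℓ₁) * ℓ₁) ^ 2 / klScale e₀ m ^ 2 + 2 * Gp₁ * (ε₂ * ℓ₁ ^ 2) / klScale e₀ m) * 1 +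
    4 * Gp₁ * ((4 + 2 * A) * ℓ₁ + ε₂ * (ρf + 2 * ℓ₁) * ℓ₁) / klScale e₀ m * (9 * (4 * Ba * ((1 + 2 * wsi) * (2 * ℓ₁)))) +
    1 * 1 * (9 * (4 * Ba * ((1 + 2 * wsi) * (2 * ℓ₁)) ^ 2 + 8 * Ba ^ 2 * ((1 + 2 * wsi) * (2 * ℓ₁)) ^ 2)))
  (hAn1 : An1 = 2 * Gp₁ * ((4 + 2 * A) * ℓ + ε₂ * (ρf + 2 * ℓ) * ℓ) / klScale e₀ m * 1 + 1 * 1 * (9 * (4 * Ba * ((1 + 2 * wsi) * (2 * ℓ)))))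
  (hAn2 : An2 = ((4 * Gp₂ + 2 * Gp₁) * ((4 + 2 * A) * ℓ + ε₂ * (ρf + 2 * ℓ) * ℓ) ^ 2 / klScale e₀ m ^ 2 + 2 * Gp₁ * (ε₂ * ℓ ^ 2) / klScale e₀ m) * 1 +
    4 * Gp₁ * ((4 + 2 * A) * ℓ + ε₂ * (ρf + 2 * ℓ) * ℓ) / klScale e₀ m * (9 * (4 * Ba * ((1 + 2 * wsi) * (2 * ℓ)))) +
    1 * 1 * (9 * (4 * Ba * ((1 + 2 * wsi) * (2 * ℓ)) ^ 2 + 8 * Ba ^ 2 * ((1 + 2 * wsi) * (2 * ℓ)) ^ 2)))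
  (hAv1 : Av1 = 2 * Gp₁ * (|2 * π / L| * (4 + 2 * A) + ε₂ * (ρf + 2 * ℓ) * ℓ) / klScale e₀ m * 1 + 1 * 1 * (9 * (4 * Ba * ((1 + 2 * wsi) * (2 * ℓ)))))
  (hAv2 : Av2 = ((4 * Gp₂ + 2 * Gp₁) * (|2 * π / L| * (4 + 2 * A) + ε₂ * (ρf + 2 * ℓ) * ℓ) ^ 2 / klScale e₀ m ^ 2 + 2 * Gp₁ * (ε₂ * ℓ ^ 2) / klScale e₀ m) * 1 +
    4 * Gp₁ * (|2 * π / L| * (4 + 2 * A) + ε₂ * (ρf + 2 * ℓ) * ℓ) / klScale e₀ m * (9 * (4 * Ba * ((1 + 2 * wsi) * (2 * ℓ)))) +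
    1 * 1 * (9 * (4 * Ba * ((1 + 2 * wsi) * (2 * ℓ)) ^ 2 + 8 * Ba ^ 2 * ((1 + 2 * wsi) * (2 * ℓ)) ^ 2)))
  -- the `x = 1` defect polynomials and amplitude (instantiate with `rfl`)
  {X₀s X₁s X₂s X₃s Tts : ℝ}
  (hX₀s : X₀s = (16 * B₁ + 16) * (β * (L : ℝ) ^ 2) / Λ ^ 2 * (G₀ / x₀ ^ 2))
  (hX₁s : X₁s = (32 * B₂ + 144 * B₁ + 128) * (β * (L : ℝ) ^ 2) / Λ ^ 3 * (G₀ / x₀ ^ 2) * (Kb₁ + (Gi₁ / x₀)) + (16 * B₁ + 16) * (β * (L : ℝ) ^ 2) / Λ ^ 2 * (Gi₁ / x₀))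
  (hX₂s : X₂s = (64 * B₃ + 480 * B₂ + 1728 * B₁ + 1536) * (β * (L : ℝ) ^ 2) / Λ ^ 4 * (G₀ / x₀ ^ 2) * (Kb₁ + (Gi₁ / x₀)) ^ 2 +
    (32 * B₂ + 144 * B₁ + 128) * (β * (L : ℝ) ^ 2) / Λ ^ 3 * ((Gi₁ / x₀) * (2 * Kb₁ + (Gi₁ / x₀))) +
    ((32 * B₂ + 144 * B₁ + 128) * (β * (L : ℝ) ^ 2) / Λ ^ 3 * (G₀ / x₀ ^ 2) * (Kb₂ + Gi₂) + (16 * B₁ + 16) * (β * (L : ℝ) ^ 2) / Λ ^ 2 * Gi₂))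
  (hX₃s : X₃s = (128 * B₄ + 1408 * B₃ + 7776 * B₂ + 27648 * B₁ + 24576) * (β * (L : ℝ) ^ 2) / Λ ^ 5 * (G₀ / x₀ ^ 2) * (Kb₁ + (Gi₁ / x₀)) ^ 3 +
    (64 * B₃ + 480 * B₂ + 1728 * B₁ + 1536) * (β * (L : ℝ) ^ 2) / Λ ^ 4 * ((Gi₁ / x₀) * (3 * Kb₁ ^ 2 + 3 * Kb₁ * (Gi₁ / x₀) + (Gi₁ / x₀) ^ 2)) +
    3 * ((64 * B₃ + 480 * B₂ + 1728 * B₁ + 1536) * (β * (L : ℝ) ^ 2) / Λ ^ 4 * (G₀ / x₀ ^ 2) * ((Kb₁ + (Gi₁ / x₀)) * (Kb₂ + Gi₂)) +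
      (32 * B₂ + 144 * B₁ + 128) * (β * (L : ℝ) ^ 2) / Λ ^ 3 * (Kb₁ * Gi₂ + (Gi₁ / x₀) * Kb₂ + (Gi₁ / x₀) * Gi₂)) +
    ((32 * B₂ + 144 * B₁ + 128) * (β * (L : ℝ) ^ 2) / Λ ^ 3 * (G₀ / x₀ ^ 2) * ((K₃s * x₀) + (Gi₃ * x₀)) + (16 * B₁ + 16) * (β * (L : ℝ) ^ 2) / Λ ^ 2 * (Gi₃ * x₀)))
  (hTts : Tts = (1 / (β * (L : ℝ) ^ 2)) ^ 2 *
    (1 * ((2 * π / β) ^ 3 * ((128 * B₄ + 1216 * B₃ + 6912 * B₂ + 26112 * B₁ + 24576) * (β * (L : ℝ) ^ 2) / Λ ^ 5 * (G₀ / x₀ ^ 2))) +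
      3 * ((2 * Gp₁ * |2 * π / β| * 1 / klScale e₀ m) * ((2 * π / β) ^ 2 * ((64 * B₃ + 416 * B₂ + 1600 * B₁ + 1536) * (β * (L : ℝ) ^ 2) / Λ ^ 4 * (G₀ / x₀ ^ 2)))) +
      3 * (((4 * Gp₂ + 2 * Gp₁) * (2 * π / β) ^ 2 * 1 / klScale e₀ m ^ 2) * ((2 * π / β) * ((32 * B₂ + 128 * B₁ + 128) * (β * (L : ℝ) ^ 2) / Λ ^ 3 * (G₀ / x₀ ^ 2)))) +
      ((8 * Gp₃ + 12 * Gp₂) * |2 * π / β| ^ 3 * 1 / klScale e₀ m ^ 3) * ((16 * B₁ + 16) * (β * (L : ℝ) ^ 2) / Λ ^ 2 * (G₀ / x₀ ^ 2))))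

  -- the rates and the `x = 1` closed amplitude (instantiate with `rfl`)
  {s₀ ρ ρ₃ : ℝ} (hs₀ : 0 < s₀) (hρ : 0 < ρ) (hρ₃ : 0 < ρ₃)
  {κA κB AΔs : ℝ}
  (hκA : κA = (8 * Gp₃ + 12 * Gp₂) * (4 + 2 * A) ^ 3 + (12 * Gp₂ + 6 * Gp₁) * (4 + 2 * A) * (4 + 4 * A) * e₀ + 2 * Gp₁ * (4 * e₀ ^ 2) +
      216 * 9 * Ba3 * ((4 * Gp₂ + 2 * Gp₁) * (4 + 2 * A) ^ 2 * (2 * e₀) + 2 * Gp₁ * (4 + 4 * A) * e₀ * (2 * e₀)) +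
      216 * 9 * Gp₁ * (4 + 2 * A) * (12 * Ba3 + 72 * Ba3 ^ 2) * (2 * e₀) ^ 2 + 216 * 9 * (12 * Ba3 + 216 * Ba3 ^ 2) * (2 * e₀) ^ 3)
  (hκB : κB = 2 * Gp₁ * (8 * (a₃s * x₀)))
  (hAΔs : AΔs = (1 / (β * (L : ℝ) ^ 2)) ^ 2 * X₀s + Tts / (4 / (s₀ * (2 * M : ℕ))) ^ 3 +
      (1 / (β * (L : ℝ) ^ 2)) ^ 2 * ((Real.sqrt 2 * ℓ₁) ^ 3 * X₃s + 3 * (Ae1 * ((Real.sqrt 2 * ℓ₁) ^ 2 * X₂s)) +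
        3 * (Ae2 * ((Real.sqrt 2 * ℓ₁) * X₁s)) + (κA + κB) * ℓ₁ ^ 3 / klScale e₀ m ^ 3 * X₀s) / (4 / (ρ / x₀ * L)) ^ 3 +
      (1 / (β * (L : ℝ) ^ 2)) ^ 2 * ((Real.sqrt 2 * ℓ) ^ 3 * X₃s + 3 * (An1 * ((Real.sqrt 2 * ℓ) ^ 2 * X₂s)) +
        3 * (An2 * ((Real.sqrt 2 * ℓ) * X₁s)) + (κA + κB) * ℓ ^ 3 / klScale e₀ m ^ 3 * X₀s) / (4 / (ρ / x₀ / (Nr - 1) * L)) ^ 3 +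
      (1 / (β * (L : ℝ) ^ 2)) ^ 2 * ((Real.sqrt 2 * ℓ) ^ 2 * X₂s + 2 * (Av1 * ((Real.sqrt 2 * ℓ) * X₁s)) + Av2 * X₀s) / (4 / (ρ₃ / x₀ / (Nr - 1) * L)) ^ 2 +
      (1 / (β * (L : ℝ) ^ 2)) ^ 2 * ((Real.sqrt 2 * ℓ) ^ 3 * X₃s + 3 * (Av1 * ((Real.sqrt 2 * ℓ) ^ 2 * X₂s)) +
        3 * (Av2 * ((Real.sqrt 2 * ℓ) * X₁s)) + (κA + κB) * ℓ ^ 3 / klScale e₀ m ^ 3 * X₀s) / (4 / (ρ / x₀ / (Nr - 1) * L)) ^ 3)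


include B Kf i₀ dn hA hA3 hA₃₀ hA₃₁ hADt he hz hz1 hgap h3 hlo hhi hβ hρA hMm hd hd1 hd2 hd3 hd4 hB0 hB hB30 hB3 hNr hLz hR₀ hx₀ hG₀pos hR hc'' hJ hO hinc
  hG₀ hGi₁ hGi₂ hGi₃ hε₃₀ hε₃₁ ha₃s hGΛ hΛ hΛΛ' hM' hKb₁ hKb₂ hKb₃ hKb₃₀ hKb₃₁ hK₃s hbs hKb₁b hb₂ hb₂' hb₃ hb₃' hB₁ hB₂ hB₃ hB₄
  hρf hκ hC₁ hε₂ hζ ht h𝔮₁ h𝔮₂ h𝔮₃₀ h𝔮₃₁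
  hd₁ hw₁ hd₂ hw₂ hd₃₀ hd₃₁ hw₃₀ hw₃₁ ho₁₀ ho₁₁ ho₂₀ ho₂₁ ho₂₂ ho₃₀ ho₃₁ ho₃₂ ho₃₃ hR₁₀ hR₁₁ hR₂₀ hR₂₁ hR₂₂ hR₃₀ hR₃₁ hR₃₂ hR₃₃
  hr₁₀ hr₁₁ hr₂₀ hr₂₁ hr₂₂ hr₃₀ hr₃₁ hr₃₂ hr₃₃ htv h𝔳₁ h𝔳₂ h𝔳₃₀ h𝔳₃₁
  hdv₁ hwv₁ hdv₂ hwv₂ hdv₃₀ hdv₃₁ hwv₃₀ hwv₃₁ hov₁₀ hov₁₁ hov₂₀ hov₂₁ hov₂₂ hov₃₀ hov₃₁ hov₃₂ hov₃₃ hRv₁₀ hRv₁₁ hRv₂₀ hRv₂₁ hRv₂₂ hRv₃₀ hRv₃₁ hRv₃₂ hRv₃₃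
  hrv₁₀ hrv₁₁ hrv₂₀ hrv₂₁ hrv₂₂ hrv₃₀ hrv₃₁ hrv₃₂ hrv₃₃ hqt₁ hqt₂ hqt₃ hDt₁ hDt₂ hθ₁ hθ₂ hθ₃ htvb
  hℓ₁ hℓ hGp₁ hGp₂ hGp₃ hwsi hτt hAe1 hAe2 hAn1 hAn2 hAv1 hAv2 hX₀s hX₁s hX₂s hX₃s hTts hs₀ hρ hρ₃ hκA hκB hAΔs in
set_option maxHeartbeats 4000000 in
/-- **The simultaneous family+band telescope along a chain of frames with mean-free flow increments, telescope form** (see the module docstring).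
[cite: BenfattoGiulianiMastropietro2006, §2.7 (2.66)–(2.67), §2.8 (2.81), §3 (3.2)–(3.8)] -/
theorem rowSumWt_sliceCT_famBand_tel_le
    -- lattice resolution of the band frame's curvature (uniform in the frame vector)
    (hLe : Kb₂ * (2 * π / L) ≤ bs) (hLv : Kb₂ * (2 * π / L * (Real.sqrt 2 * (Nr + 1 / 2))) ≤ bs)
    -- rates, time condition, coefficients, thresholds
    {k₁ k₂ k₃ : ℝ}
    (hk₁ : k₁ = (16 * B₁ + 16) / Λ ^ 2) (hk₂ : k₂ = (32 * B₂ + 144 * B₁ + 128) / Λ ^ 3) (hk₃ : k₃ = (64 * B₃ + 480 * B₂ + 1728 * B₁ + 1536) / Λ ^ 4)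
    (htime : (1 / (β * (L : ℝ) ^ 2)) ^ 2 *
        (1 * ((2 * π / β) ^ 3 * ((64 * B₃ + 480 * B₂ + 1728 * B₁ + 1536) * (β * (L : ℝ) ^ 2) / Λ ^ 4)) +
          3 * (θ₁ * ((2 * π / β) ^ 2 * ((32 * B₂ + 144 * B₁ + 128) * (β * (L : ℝ) ^ 2) / Λ ^ 3))) +
          3 * (θ₂ * ((2 * π / β) * ((16 * B₁ + 16) * (β * (L : ℝ) ^ 2) / Λ ^ 2))) +
          θ₃ * (4 * (β * (L : ℝ) ^ 2) / Λ)) ≤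
      (1 / (β * (L : ℝ) ^ 2)) ^ 2 * (4 * (β * (L : ℝ) ^ 2) / Λ) * (4 / (s₀ * (2 * M : ℕ))) ^ 3)
    {C₀ C₁' C₂ C₃ Cv₀ Cv₁ Cv₂ Cv₃ Cw₀ Cw₁ Cw₂ Kc Kw : ℝ}
    (hC₀ : C₀ = 343 * k₃ * (β * (L : ℝ) ^ 2) * bs ^ 3 + 21 * k₂ * (β * (L : ℝ) ^ 2) * bs * b₂ + k₁ * (β * (L : ℝ) ^ 2) * b₃ +
      3 * r₁₀ * (36 * k₂ * (β * (L : ℝ) ^ 2) * bs ^ 2 + k₁ * (β * (L : ℝ) ^ 2) * b₂) + 15 * r₂₀ * k₁ * (β * (L : ℝ) ^ 2) * bs + r₃₀ * (4 * (β * (L : ℝ) ^ 2) / Λ))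
    (hC₁' : C₁' = 21 * k₂ * (β * (L : ℝ) ^ 2) * bs * b₂' + k₁ * (β * (L : ℝ) ^ 2) * b₃' + 3 * r₁₁ * (36 * k₂ * (β * (L : ℝ) ^ 2) * bs ^ 2 + k₁ * (β * (L : ℝ) ^ 2) * b₂) +
      3 * r₁₀ * (k₁ * (β * (L : ℝ) ^ 2) * b₂') + 15 * r₂₁ * k₁ * (β * (L : ℝ) ^ 2) * bs + r₃₁ * (4 * (β * (L : ℝ) ^ 2) / Λ))
    (hC₂ : C₂ = 3 * r₁₁ * (k₁ * (β * (L : ℝ) ^ 2) * b₂') + 15 * r₂₂ * k₁ * (β * (L : ℝ) ^ 2) * bs + r₃₂ * (4 * (β * (L : ℝ) ^ 2) / Λ))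
    (hC₃ : C₃ = r₃₃ * (4 * (β * (L : ℝ) ^ 2) / Λ))
    (hCv₀ : Cv₀ = 343 * k₃ * (β * (L : ℝ) ^ 2) * bs ^ 3 + 21 * k₂ * (β * (L : ℝ) ^ 2) * bs * b₂ + k₁ * (β * (L : ℝ) ^ 2) * b₃ +
      3 * rv₁₀ * (36 * k₂ * (β * (L : ℝ) ^ 2) * bs ^ 2 + k₁ * (β * (L : ℝ) ^ 2) * b₂) + 15 * rv₂₀ * k₁ * (β * (L : ℝ) ^ 2) * bs + rv₃₀ * (4 * (β * (L : ℝ) ^ 2) / Λ))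
    (hCv₁ : Cv₁ = 21 * k₂ * (β * (L : ℝ) ^ 2) * bs * b₂' + k₁ * (β * (L : ℝ) ^ 2) * b₃' + 3 * rv₁₁ * (36 * k₂ * (β * (L : ℝ) ^ 2) * bs ^ 2 + k₁ * (β * (L : ℝ) ^ 2) * b₂) +
      3 * rv₁₀ * (k₁ * (β * (L : ℝ) ^ 2) * b₂') + 15 * rv₂₁ * k₁ * (β * (L : ℝ) ^ 2) * bs + rv₃₁ * (4 * (β * (L : ℝ) ^ 2) / Λ))
    (hCv₂ : Cv₂ = 3 * rv₁₁ * (k₁ * (β * (L : ℝ) ^ 2) * b₂') + 15 * rv₂₂ * k₁ * (β * (L : ℝ) ^ 2) * bs + rv₃₂ * (4 * (β * (L : ℝ) ^ 2) / Λ))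
    (hCv₃ : Cv₃ = rv₃₃ * (4 * (β * (L : ℝ) ^ 2) / Λ))
    (hCw₀ : Cw₀ = 25 * k₂ * (β * (L : ℝ) ^ 2) * bs ^ 2 + k₁ * (β * (L : ℝ) ^ 2) * b₂ + 8 * rv₁₀ * k₁ * (β * (L : ℝ) ^ 2) * bs + rv₂₀ * (4 * (β * (L : ℝ) ^ 2) / Λ))
    (hCw₁ : Cw₁ = k₁ * (β * (L : ℝ) ^ 2) * b₂' + 8 * rv₁₁ * k₁ * (β * (L : ℝ) ^ 2) * bs + rv₂₁ * (4 * (β * (L : ℝ) ^ 2) / Λ))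
    (hCw₂ : Cw₂ = rv₂₂ * (4 * (β * (L : ℝ) ^ 2) / Λ))
    (hKc : Kc = 32 * (β * (L : ℝ) ^ 2) / (π ^ 3 * Λ)) (hKw : Kw = 16 * (β * (L : ℝ) ^ 2) / (π ^ 2 * Λ))
    (th₃ : 4 * C₃ * ρ ^ 3 ≤ Kc) (th₂ : 4 * C₂ * ρ ^ 3 ≤ Kc * x₀) (th₁ : 4 * C₁' * ρ ^ 3 ≤ Kc * x₀ ^ 2) (th₀ : 4 * C₀ * ρ ^ 3 ≤ Kc * x₀ ^ 3)
    (tv₃ : 4 * Cv₃ * ρ ^ 3 ≤ Kc) (tv₂ : 4 * Cv₂ * ρ ^ 3 ≤ Kc * x₀) (tv₁ : 4 * Cv₁ * ρ ^ 3 ≤ Kc * x₀ ^ 2) (tv₀ : 4 * Cv₀ * ρ ^ 3 ≤ Kc * x₀ ^ 3)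
    (tw₂ : 3 * Cw₂ * ρ₃ ^ 2 ≤ Kw) (tw₁ : 3 * Cw₁ * ρ₃ ^ 2 ≤ Kw * x₀) (tw₀ : 3 * Cw₀ * ρ₃ ^ 2 ≤ Kw * x₀ ^ 2)
    -- the weight scale, dominated by the rates
    -- the weight scale, dominated by the rates
    (nw : ℕ) {Dw : ℝ} (hDw : 1 ≤ Dw * x₀) (hdom₀ : klScale klE0 nw * β / (2 * M) ≤ Dw * x₀ * s₀) (hdom₁ : klScale klE0 nw ≤ Dw * ρ)
    -- the two pieces' bounds (instantiate with `rfl`)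
    {Φ Ψ : ℝ}
    (hΦ : Φ = 8 * ((18 : ℕ) * (Dw * (2 * (Real.sqrt (524288 * (1 / s₀ + 1) * ((1 + 4 * Real.sqrt 2) ^ 2 * ((2 * Real.sqrt 2 / ρ + 2) * (2 * Real.sqrt 2 / ρ₃ + 2)) + (1 / ρ + 1) ^ 2)) *
        Real.sqrt (24 * (2 * M : ℕ) * (L : ℝ) ^ 2 *
          ((klScale e₀ m * β / π + 1) *
            ((Real.sqrt 2 * L * ((klScale e₀ m + (4 + 4 * A) * ρf ^ 2) / (2 * B.rhomin - 4 * A)) / π + 2) *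
              (Real.sqrt 2 * L * (2 * ρf) / π + 2)))) *
        (C₁ * (G₀ * (5 * klScale e₀ m)) * ((1 / (β * (L : ℝ) ^ 2)) ^ 2 * (4 * (β * (L : ℝ) ^ 2) / Λ))))))))
    (hΨ : Ψ = 8 * ((9 : ℕ) * (Dw * x₀ * (Real.sqrt (524288 * (1 / s₀ + 1) * ((1 + 4 * Real.sqrt 2) ^ 2 * ((2 * Real.sqrt 2 / (ρ / x₀) + 2) * (2 * Real.sqrt 2 / (ρ₃ / x₀) + 2)) + (1 / (ρ / x₀) + 1) ^ 2)) *
        Real.sqrt (24 * (2 * M : ℕ) * (L : ℝ) ^ 2 *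
          ((klScale e₀ m * β / π + 1) *
            ((Real.sqrt 2 * L * ((klScale e₀ m + (4 + 4 * A) * ρf ^ 2) / (2 * B.rhomin - 4 * A)) / π + 2) *
              (Real.sqrt 2 * L * (2 * ρf) / π + 2)))) * AΔs)))) :
    (∀ Y : SpaceTimeIdx L M × SectorLeg (sectorCount (m + 1)),
      ∑ Y' : SpaceTimeIdx L M × SectorLeg (sectorCount (m + 1)),
        ‖((sectorSubMatrix L M β (bgmFatMultiplier L M e₀ β (nambuXiCT L μ (Kf (i₀ + dn))) (m + 1))).transpose * hubbardCovSliceCT L M β μ 0 (Kf (i₀ + dn)) Λ Λ' *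
            sectorSubMatrix L M β (bgmFatMultiplier L M e₀ β (nambuXiCT L μ (Kf (i₀ + dn))) (m + 1))) Y Y'‖ *
          EngineV8.klScaleWt L M β nw {EngineV8.latticeLegPos (2 * (2 * M)) Y, EngineV8.latticeLegPos (2 * (2 * M)) Y'} ≤
      ∑ Y' : SpaceTimeIdx L M × SectorLeg (sectorCount (m + 1)),
        ‖((sectorSubMatrix L M β (bgmFatMultiplier L M e₀ β (nambuXiCT L μ (Kf i₀)) (m + 1))).transpose * hubbardCovSliceCT L M β μ 0 (Kf i₀) Λ Λ' *
            sectorSubMatrix L M β (bgmFatMultiplier L M e₀ β (nambuXiCT L μ (Kf i₀)) (m + 1))) Y Y'‖ *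
          EngineV8.klScaleWt L M β nw {EngineV8.latticeLegPos (2 * (2 * M)) Y, EngineV8.latticeLegPos (2 * (2 * M)) Y'} + (dn : ℝ) * (Φ + Ψ)) ∧
    (∀ Y' : SpaceTimeIdx L M × SectorLeg (sectorCount (m + 1)),
      ∑ Y : SpaceTimeIdx L M × SectorLeg (sectorCount (m + 1)),
        ‖((sectorSubMatrix L M β (bgmFatMultiplier L M e₀ β (nambuXiCT L μ (Kf (i₀ + dn))) (m + 1))).transpose * hubbardCovSliceCT L M β μ 0 (Kf (i₀ + dn)) Λ Λ' *
            sectorSubMatrix L M β (bgmFatMultiplier L M e₀ β (nambuXiCT L μ (Kf (i₀ + dn))) (m + 1))) Y Y'‖ *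
          EngineV8.klScaleWt L M β nw {EngineV8.latticeLegPos (2 * (2 * M)) Y, EngineV8.latticeLegPos (2 * (2 * M)) Y'} ≤
      ∑ Y : SpaceTimeIdx L M × SectorLeg (sectorCount (m + 1)),
        ‖((sectorSubMatrix L M β (bgmFatMultiplier L M e₀ β (nambuXiCT L μ (Kf i₀)) (m + 1))).transpose * hubbardCovSliceCT L M β μ 0 (Kf i₀) Λ Λ' *
            sectorSubMatrix L M β (bgmFatMultiplier L M e₀ β (nambuXiCT L μ (Kf i₀)) (m + 1))) Y Y'‖ *
          EngineV8.klScaleWt L M β nw {EngineV8.latticeLegPos (2 * (2 * M)) Y, EngineV8.latticeLegPos (2 * (2 * M)) Y'} + (dn : ℝ) * (Φ + Ψ)) := by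
  have hx₀1 : 1 ≤ x₀ := by rw [hx₀]; exact one_le_pow₀ (by norm_num)
  have hx₀0 : 0 < x₀ := one_pos.trans_le hx₀1
  have hKc0 : 0 ≤ Kc := by rw [hKc]; positivity
  have hKw0 : 0 ≤ Kw := by rw [hKw]; positivity
  have hDw0 : 0 ≤ Dw := ((pos_iff_pos_of_mul_pos (one_pos.trans_le hDw)).2 hx₀0).le
  have hu : ∀ j, 0 ≤ uPow j U := fun j => uPow_nonneg' j U
  have hGi₁0 : 0 ≤ Gi₁ := by rw [hGi₁]; exact mul_nonneg (hR 1) (hu 1)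
  have ha3s0 : 0 ≤ a₃s := le_trans (mul_nonneg (add_nonneg hA₃₀ hA₃₁) (sq_nonneg (klScale e₀ m))) ha₃s
  have hK₃s0 : 0 ≤ K₃s := le_trans (add_nonneg hKb₃₀ hKb₃₁) hK₃s
  obtain ⟨hε₃₀0, hε₃₁0⟩ : 0 ≤ ε₃₀ ∧ 0 ≤ ε₃₁ := ⟨by rw [hε₃₀]; positivity, by rw [hε₃₁]; positivity⟩
  -- the chain, its steps' two pieces
  obtain ⟨Am, hAm⟩ : ∃ Am : ℕ → Matrix (SpaceTimeIdx L M × SectorLeg (sectorCount (m + 1))) (SpaceTimeIdx L M × SectorLeg (sectorCount (m + 1))) ℂ,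
      Am = fun i => (sectorSubMatrix L M β (bgmFatMultiplier L M e₀ β (nambuXiCT L μ (Kf i)) (m + 1))).transpose * hubbardCovSliceCT L M β μ 0 (Kf i) Λ Λ' *
        sectorSubMatrix L M β (bgmFatMultiplier L M e₀ β (nambuXiCT L μ (Kf i)) (m + 1)) := ⟨_, rfl⟩
  obtain ⟨Fm, hFm⟩ : ∃ Fm : ℕ → Matrix (SpaceTimeIdx L M × SectorLeg (sectorCount (m + 1))) (SpaceTimeIdx L M × SectorLeg (sectorCount (m + 1))) ℂ,
      Fm = fun k => (sectorSubMatrix L M β (bgmFatMultiplier L M e₀ β (nambuXiCT L μ (Kf (i₀ + k + 1))) (m + 1))).transpose * hubbardCovSliceCT L M β μ 0 (Kf (i₀ + k + 1)) Λ Λ' *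
          sectorSubMatrix L M β (bgmFatMultiplier L M e₀ β (nambuXiCT L μ (Kf (i₀ + k + 1))) (m + 1)) -
        (sectorSubMatrix L M β (bgmFatMultiplier L M e₀ β (nambuXiCT L μ (Kf (i₀ + k))) (m + 1))).transpose * hubbardCovSliceCT L M β μ 0 (Kf (i₀ + k + 1)) Λ Λ' *
          sectorSubMatrix L M β (bgmFatMultiplier L M e₀ β (nambuXiCT L μ (Kf (i₀ + k))) (m + 1)) := ⟨_, rfl⟩
  obtain ⟨Cm, hCm⟩ : ∃ Cm : ℕ → Matrix (SpaceTimeIdx L M × SectorLeg (sectorCount (m + 1))) (SpaceTimeIdx L M × SectorLeg (sectorCount (m + 1))) ℂ,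
      Cm = fun k => (sectorSubMatrix L M β (bgmFatMultiplier L M e₀ β (nambuXiCT L μ (Kf (i₀ + k))) (m + 1))).transpose *
        (hubbardCovSliceCT L M β μ 0 (Kf (i₀ + k + 1)) Λ Λ' - hubbardCovSliceCT L M β μ 0 (Kf (i₀ + k)) Λ Λ') *
        sectorSubMatrix L M β (bgmFatMultiplier L M e₀ β (nambuXiCT L μ (Kf (i₀ + k))) (m + 1)) := ⟨_, rfl⟩
  have hw : ∀ Y Y' : SpaceTimeIdx L M × SectorLeg (sectorCount (m + 1)),
      0 ≤ EngineV8.klScaleWt L M β nw {EngineV8.latticeLegPos (2 * (2 * M)) Y, EngineV8.latticeLegPos (2 * (2 * M)) Y'} := fun Y Y' =>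
    zero_le_one.trans (EngineV8.one_le_klScaleWt L M β nw _)
  have hsplit : ∀ k < dn, Am (i₀ + k + 1) - Am (i₀ + k) = Fm k + Cm k := fun k _ => by
    rw [hAm, hFm, hCm]
    exact conj_step_split (γ := Unit) (sectorSubMatrix L M β (bgmFatMultiplier L M e₀ β (nambuXiCT L μ (Kf (i₀ + k))) (m + 1)))
      (sectorSubMatrix L M β (bgmFatMultiplier L M e₀ β (nambuXiCT L μ (Kf (i₀ + k + 1))) (m + 1)))
      (hubbardCovSliceCT L M β μ 0 (Kf (i₀ + k)) Λ Λ') (hubbardCovSliceCT L M β μ 0 (Kf (i₀ + k + 1)) Λ Λ')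
  -- the two pieces at every step of the chain
  have step : ∀ k, k < dn →
      ((∀ Y, ∑ Y', ‖Fm k Y Y'‖ * EngineV8.klScaleWt L M β nw {EngineV8.latticeLegPos (2 * (2 * M)) Y, EngineV8.latticeLegPos (2 * (2 * M)) Y'} ≤ Φ) ∧
        (∀ Y', ∑ Y, ‖Fm k Y Y'‖ * EngineV8.klScaleWt L M β nw {EngineV8.latticeLegPos (2 * (2 * M)) Y, EngineV8.latticeLegPos (2 * (2 * M)) Y'} ≤ Φ)) ∧
      ((∀ Y, ∑ Y', ‖Cm k Y Y'‖ * EngineV8.klScaleWt L M β nw {EngineV8.latticeLegPos (2 * (2 * M)) Y, EngineV8.latticeLegPos (2 * (2 * M)) Y'} ≤ Ψ) ∧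
        (∀ Y', ∑ Y, ‖Cm k Y Y'‖ * EngineV8.klScaleWt L M β nw {EngineV8.latticeLegPos (2 * (2 * M)) Y, EngineV8.latticeLegPos (2 * (2 * M)) Y'} ≤ Ψ)) := by
    intro k hk
    have hi0 : i₀ ≤ i₀ + k := Nat.le_add_right _ _
    have hik : i₀ + k ≤ i₀ + dn := by omega
    have hik1 : i₀ + k + 1 ≤ i₀ + dn := by omega
    have hi01 : i₀ ≤ i₀ + k + 1 := by omega
    have hlt : i₀ + k < i₀ + dn := by omega
    have hxx : x₀ ≤ (4 : ℝ) ^ (i₀ + k) := by rw [hx₀]; exact pow_le_pow_right₀ (by norm_num) hi0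
    have hx1 : (1 : ℝ) ≤ (4 : ℝ) ^ (i₀ + k) := hx₀1.trans hxx
    have hxpos : (0 : ℝ) < (4 : ℝ) ^ (i₀ + k) := by positivity
    have hDwk : 1 ≤ Dw * (4 : ℝ) ^ (i₀ + k) := hDw.trans (mul_le_mul_of_nonneg_left hxx hDw0)
    have hdom₀k : klScale klE0 nw * β / (2 * M) ≤ Dw * (4 : ℝ) ^ (i₀ + k) * s₀ :=
      hdom₀.trans (mul_le_mul_of_nonneg_right (mul_le_mul_of_nonneg_left hxx hDw0) hs₀.le)
    have e4 : (4 : ℝ) ^ (i₀ + k + 1) = 4 * (4 : ℝ) ^ (i₀ + k) := by rw [pow_succ]; ring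
    have hxx2 : x₀ ^ 2 ≤ ((4 : ℝ) ^ (i₀ + k)) ^ 2 := pow_le_pow_left₀ hx₀0.le hxx 2
    have hxx3 : x₀ ^ 3 ≤ ((4 : ℝ) ^ (i₀ + k)) ^ 3 := pow_le_pow_left₀ hx₀0.le hxx 3
    have mono1 : ∀ {C K : ℝ}, 0 ≤ K → C ≤ K * x₀ → C ≤ K * (4 : ℝ) ^ (i₀ + k) := fun hK h => h.trans (mul_le_mul_of_nonneg_left hxx hK)
    have mono2 : ∀ {C K : ℝ}, 0 ≤ K → C ≤ K * x₀ ^ 2 → C ≤ K * ((4 : ℝ) ^ (i₀ + k)) ^ 2 := fun hK h => h.trans (mul_le_mul_of_nonneg_left hxx2 hK)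
    have mono3 : ∀ {C K : ℝ}, 0 ≤ K → C ≤ K * x₀ ^ 3 → C ≤ K * ((4 : ℝ) ^ (i₀ + k)) ^ 3 := fun hK h => h.trans (mul_le_mul_of_nonneg_left hxx3 hK)
    -- the family piece's step data (new band `K_f(i+1)`, old family `K_f(i)`)
    have hA3n : ∀ p : Momentum, ‖iteratedFDeriv ℝ 3 (frameShift (Kf (i₀ + k + 1))) p‖ ≤ A₃₀ + A₃₁ * (4 : ℝ) ^ (i₀ + k + 1) := hA3 _ hi01 hik1
    have hA3o : ∀ p : Momentum, ‖iteratedFDeriv ℝ 3 (frameShift (Kf (i₀ + k))) p‖ ≤ A₃₀ + A₃₁ * (4 : ℝ) ^ (i₀ + k + 1) := fun p =>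
      (hA3 _ hi0 hik p).trans (by rw [e4]; nlinarith only [hA₃₁, hxpos])
    have hA₃x : 4 + 8 * (A₃₀ + A₃₁ * (4 : ℝ) ^ (i₀ + k + 1)) ≤ ε₃₀ + ε₃₁ * (4 : ℝ) ^ (i₀ + k) := by rw [hε₃₀, hε₃₁, e4]; exact le_of_eq (by ring)
    have hGΛ' : G₀ / ((4 : ℝ) ^ (i₀ + k)) ^ 2 ≤ klScale e₀ m := (div_le_div_of_nonneg_left hG₀pos.le (by positivity) hxx2).trans hGΛ
    have hKb₂x : Kb₂ ≤ b₂ + b₂' * (4 : ℝ) ^ (i₀ + k) := hb₂.trans (le_add_of_nonneg_right (mul_nonneg hb₂' hxpos.le))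
    have hKb₃x : Kb₃₀ + Kb₃₁ * (4 : ℝ) ^ (i₀ + k + 1) ≤ b₃ + b₃' * (4 : ℝ) ^ (i₀ + k) := by rw [e4]; nlinarith only [hb₃, hb₃', hKb₃₁, hxpos]
    have htvb' : tv + Gi₁ / (4 : ℝ) ^ (i₀ + k) ≤ bs := by
      have h := div_le_div_of_nonneg_left hGi₁0 hx₀0 hxx
      linarith only [h, htvb]
    -- the covariance piece's step data (old family and band `K_f(i)`, new band `K_f(i+1)`)
    have ha3' : (A₃₀ + A₃₁ * (4 : ℝ) ^ (i₀ + k)) * klScale e₀ m ^ 2 ≤ a₃s * (4 : ℝ) ^ (i₀ + k) := by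
      have h1 : A₃₀ + A₃₁ * (4 : ℝ) ^ (i₀ + k) ≤ (A₃₀ + A₃₁) * (4 : ℝ) ^ (i₀ + k) := by nlinarith only [hA₃₀, hx1]
      calc (A₃₀ + A₃₁ * (4 : ℝ) ^ (i₀ + k)) * klScale e₀ m ^ 2 ≤ (A₃₀ + A₃₁) * (4 : ℝ) ^ (i₀ + k) * klScale e₀ m ^ 2 :=
            mul_le_mul_of_nonneg_right h1 (sq_nonneg _)
        _ = (A₃₀ + A₃₁) * klScale e₀ m ^ 2 * (4 : ℝ) ^ (i₀ + k) := by ring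
        _ ≤ a₃s * (4 : ℝ) ^ (i₀ + k) := mul_le_mul_of_nonneg_right ha₃s hxpos.le
    have hK₃' : ∀ p, ‖iteratedFDeriv ℝ 3 (frameLevel μ (Kf (i₀ + k))) p‖ ≤ K₃s * (4 : ℝ) ^ (i₀ + k) := fun p =>
      (hKb₃ _ hi0 hik p).trans (by nlinarith only [hK₃s, hKb₃₀, hKb₃₁, hx1])
    have hf := rowSumWt_sliceCT_famDefect_pieceTel_le (K := Kf (i₀ + k + 1)) (K' := Kf (i₀ + k)) (i := i₀ + k) (x := (4 : ℝ) ^ (i₀ + k))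
        B (hA _ hi01 hik1) hA3n (hA _ hi0 hik) hA3o hADt he hz hz1 hgap h3 hlo hhi hβ hρA m hMm
        hd hd1 hd2 hd3 hd4 hB30 hB3 (hKb₂ _ hi01 hik1) (hKb₂ _ hi0 hik) hNr hLz hx1 hG₀pos hε₃₀0 hε₃₁0
        hR rfl (hJ _ hi0 hlt) (hO _ hi0 hlt) (hinc _ hi0 hlt) hG₀ hGi₁ hGi₂ hGi₃ hGΛ' hA₃x hΛ hΛΛ' hM'
        (hKb₁ _ hi01 hik1) (hKb₂ _ hi01 hik1) (hKb₃ _ hi01 hik1) hbs hKb₁b hKb₂x hKb₃x hB₁ hB₂ hB₃ hρf hκ hC₁ rfl hε₂ hζ ht h𝔮₁ h𝔮₂ h𝔮₃₀ h𝔮₃₁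
        hd₁ hw₁ hd₂ hw₂ hd₃₀ hd₃₁ hw₃₀ hw₃₁ ho₁₀ ho₁₁ ho₂₀ ho₂₁ ho₂₂ ho₃₀ ho₃₁ ho₃₂ ho₃₃ hR₁₀ hR₁₁ hR₂₀ hR₂₁ hR₂₂ hR₃₀ hR₃₁ hR₃₂ hR₃₃
        hr₁₀ hr₁₁ hr₂₀ hr₂₁ hr₂₂ hr₃₀ hr₃₁ hr₃₂ hr₃₃ htv h𝔳₁ h𝔳₂ h𝔳₃₀ h𝔳₃₁
        hdv₁ hwv₁ hdv₂ hwv₂ hdv₃₀ hdv₃₁ hwv₃₀ hwv₃₁ hov₁₀ hov₁₁ hov₂₀ hov₂₁ hov₂₂ hov₃₀ hov₃₁ hov₃₂ hov₃₃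
        hRv₁₀ hRv₁₁ hRv₂₀ hRv₂₁ hRv₂₂ hRv₃₀ hRv₃₁ hRv₃₂ hRv₃₃ hrv₁₀ hrv₁₁ hrv₂₀ hrv₂₁ hrv₂₂ hrv₃₀ hrv₃₁ hrv₃₂ hrv₃₃
        hqt₁ hqt₂ hqt₃ hDt₁ hDt₂ hθ₁ hθ₂ hθ₃ htvb' hLe hLv hs₀ hρ hρ₃ hk₁ hk₂ hk₃ htime hC₀ hC₁' hC₂ hC₃ hCv₀ hCv₁ hCv₂ hCv₃ hCw₀ hCw₁ hCw₂ hKc hKw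
        th₃ (mono1 hKc0 th₂) (mono2 hKc0 th₁) (mono3 hKc0 th₀) tv₃ (mono1 hKc0 tv₂) (mono2 hKc0 tv₁) (mono3 hKc0 tv₀) tw₂ (mono1 hKw0 tw₁) (mono2 hKw0 tw₀)
        nw hDwk hdom₀k hdom₁
    have hc := rowSumWt_sliceCT_covDefect_pieceTel_le (K := Kf (i₀ + k)) (K' := Kf (i₀ + k + 1)) (i := i₀ + k) (x := (4 : ℝ) ^ (i₀ + k)) (x₀ := x₀)
        B hx₀1 hxx (hA _ hi0 hik) hADt he hz hz1 hgap h3 hlo hhi hβ hρA m hMm hd hd1 hd2 hd3 (hA3 _ hi0 hik) ha3' ha3s0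
        hB0 hB hB30 hB3 hΛ hΛΛ' hM' (hKb₁ _ hi0 hik) (hKb₂ _ hi0 hik) hK₃' hK₃s0 hB₁ hB₂ hB₃ hB₄ hR hc'' rfl (hJ _ hi0 hlt) (hO _ hi0 hlt) (hinc _ hi0 hlt)
        hG₀ hGi₁ hGi₂ hGi₃ hNr hLz hR₀ hℓ₁ hℓ hρf hGp₁ hGp₂ hGp₃ hε₂ hwsi hτt hAe1 hAe2 hAn1 hAn2 hAv1 hAv2 hX₀s hX₁s hX₂s hX₃s hTts hs₀ hρ hρ₃ hκA hκB hAΔs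
        nw hDwk hdom₀k hdom₁
    rw [hFm, hCm, hΦ, hΨ]
    exact ⟨hf, hc⟩
  refine ⟨fun Y => ?_, fun Y' => ?_⟩
  · have h := rowSumWt_norm_chain_le_const Am Fm Cm
      (fun Y Y' => EngineV8.klScaleWt L M β nw {EngineV8.latticeLegPos (2 * (2 * M)) Y, EngineV8.latticeLegPos (2 * (2 * M)) Y'}) hw i₀ dn Y hsplit
      (fun k hk => (step k hk).1.1 Y) (fun k hk => (step k hk).2.1 Y)
    rw [hAm] at h
    exact h
  · have h := colSumWt_norm_chain_le_const Am Fm Cm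
      (fun Y Y' => EngineV8.klScaleWt L M β nw {EngineV8.latticeLegPos (2 * (2 * M)) Y, EngineV8.latticeLegPos (2 * (2 * M)) Y'}) hw i₀ dn Y' hsplit
      (fun k hk => (step k hk).1.2 Y') (fun k hk => (step k hk).2.2 Y')
    rw [hAm] at h
    exact h

end TelescopeTel

end Summit.HubbardSuperconductivity.HubbardSuperconductivity.Theorems.TorusFourierL2

end
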